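import Literature.Barriers.ValiantsHypothesis.BIJL18BorderCompletionRankProofs
import HarnessLib

/-!
# Bläser–Ikenmeyer–Jindal–Lysikov 2018, Obs. 17 — `im g ⊆ C^{n,t,c}_r ⊆ \overline{im g}`
# (the half of "the closure of the image of `g` is `C^{n,t,c}_r`" that holds over every infinite field)

Theorem-only companion of `BIJL18MatrixCompletion.lean` (val-lit cell, seat t23). Source:
[BlaserIkenmeyerJindalLysikov2018], Obs. 17 (ECCC TR18-064 p.12): "The variety `C^{n,t,c}_r` of all
such tensors [border completion rank `≤ r`, `rk(Aᵢ) ≤ c`] is irreducible: We can think of `g`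
constructed in Lemma 16 as a polynomial map … The closure of the image of `g` is `C^{n,t,c}_r`."

The tree types `C^{n,t,c}_r` literally (`bijlVariety`: `\underline{CR} ≤ r ∧ ∀ k, rk A_k ≤ c`, with
the border rank of Def. 9 over `K(ε)`, rank-constrained approximants) and the vanishing ideal of the
image of `g` (`lemma16VanishingIdeal`, prime: `BIJL2018_obs17`). This file proves, over every
INFINITE field `K`, the two inclusions
* `lemma16Map_mem_bijlVariety` : `im g ⊆ C^{n,t,c}_r` (Lemma 16 and `\underline{CR} ≤ CR`), and
* `bijlVariety_subset_zeroLocus_lemma16VanishingIdeal` : `C^{n,t,c}_r ⊆ Z(I(im g)) = \overline{im g}` —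
  every equation of the image of `g` vanishes on `C^{n,t,c}_r`: a Def. 9 witness `(Ã₀, Ã, λ)` over
  `K(ε)` lies in the image of `g` over the field `K(ε)` (Lemma 16 there, with the rank constraints
  `rk Ã_k ≤ rk A_k ≤ c`), `p ∘ g = 0` is a polynomial identity (`mem_lemma16VanishingIdeal_iff`), so
  `p(Ã) = 0`, and `p(Ã) = p(A) + O(ε)` (`IsApproxOf.eval_map`).
The converse inclusion `\overline{im g} ⊆ C^{n,t,c}_r` (every point of the Zariski closure is an
`ε`-limit of image points with the rank constraints) is NOT proved here, and — CORRECTION (val-lit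
registry A44, lead-np RULING (109); this docstring previously said "it holds over algebraically closed
`K`") — it is FALSE in general under Def. 9's rank-RESTRICTED approximations, over every infinite `K`
including algebraically closed ones: for `r < n ≤ c·t` the tensor `(I_n; 0, …, 0)` (all slices zero,
so every admissible approximation of a slice is `0`) lies in `Z(I(im g))` but has `\underline{CR} = n > r`
(`BIJL2018Thm4S.eval_eq_zero_one_zero`, `BIJL2018Thm4S.borderCompletionRank_one_zero`,
`BIJL2018Thm4S.not_exists_equations_of_lt` in the sibling `BIJL18Thm4StrengthenedVacuity.lean`); what
holds is exactly the sandwich proved in this file, and the typed `BIJL2018_thm4_strengthened` is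
vacuous as typed (`BIJL2018_thm4_strengthened_vacuous`: its `∀ n`-hypothesis has no instance `S` for
the discharge's parameters). HONEST FRAMING: typed literature; `VP ≠ VNP` is NOT proved.
-/

noncomputable section

namespace Literature.Barriers.ValiantsHypothesis

open MvPolynomial

universe u

variable {K : Type u} [Field K]

/-- Powers of approximations. [cite: BlaserIkenmeyerJindalLysikov2018, Def. 9] locator: ECCC p.8 -/
theorem IsApproxOf.pow {a : K} {f : RatFunc K} (h : IsApproxOf a f) :
    ∀ m : ℕ, IsApproxOf (a ^ m) (f ^ m)
  | 0 => by simpa using (isApproxOf_one (K := K))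
  | m + 1 => by
    rw [pow_succ, pow_succ]
    exact (h.pow m).mul h

/-- **Polynomial maps respect `= + O(ε)`**: if `f_v = a_v + O(ε)` for every coordinate then
`p(f) = p(a) + O(ε)` for every polynomial `p` with coefficients in `K` ("Since `p` is a polynomial,
it also vanishes on all tensors of border completion rank …", proof of Thm. 4).
[cite: BlaserIkenmeyerJindalLysikov2018, §3 (proof of Thm. 4) and Def. 9] locator: ECCC pp.8, 11–12 -/
theorem IsApproxOf.eval_map {σ : Type*} {a : σ → K} {f : σ → RatFunc K}
    (h : ∀ v, IsApproxOf (a v) (f v)) (p : MvPolynomial σ K) :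
    IsApproxOf (eval a p) (eval f (map RatFunc.C p)) := by
  classical
  rw [MvPolynomial.eval_eq, MvPolynomial.eval_map, MvPolynomial.eval₂_eq]
  refine IsApproxOf.sum _ fun d _ => ?_
  exact (isApproxOf_C _).mul (IsApproxOf.prod _ fun i _ => (h i).pow _)

/-- `a = 0 + O(ε)` forces `a = 0`. [cite: BlaserIkenmeyerJindalLysikov2018, Def. 9] locator: ECCC p.8 -/
theorem IsApproxOf.eq_zero_of_zero {a : K} (h : IsApproxOf a 0) : a = 0 := by
  have h2 := h.2
  rw [RatFunc.eval_zero] at h2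
  exact h2.symm

/-- The coordinates of `g` base-change along `K → K(ε)`.
[cite: BlaserIkenmeyerJindalLysikov2018, Lemma 16 and Obs. 17] locator: ECCC pp.11–12 -/
theorem map_C_lemma16Poly (n t c r : ℕ) (v : Option (Fin t) × Fin n × Fin n) :
    map RatFunc.C (lemma16Poly K n t c r v) = lemma16Poly (RatFunc K) n t c r v := by
  rcases v with ⟨_ | k, i, j⟩ <;> simp [lemma16Poly, map_X]

/-- **`im g ⊆ C^{n,t,c}_r`**: every tensor `g(U₀, V₀, U, V, z)` has border completion rank `≤ r` and
slices of rank `≤ c` (Lemma 16 and `\underline{CR} ≤ CR`).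
[cite: BlaserIkenmeyerJindalLysikov2018, Obs. 17 (with Lemma 16)] locator: ECCC pp.11–12 -/
theorem lemma16Map_mem_bijlVariety {n t c r : ℕ} (U₀ V₀ : Matrix (Fin r) (Fin n) K)
    (U V : Fin t → Matrix (Fin c) (Fin n) K) (z : Fin t → K) :
    lemma16Map K r (fun _ => c) U₀ V₀ U V z ∈ bijlVariety K n t c r := by
  have h := (BIJL2018_lemma16 K n t r (fun _ => c) (lemma16Map K r (fun _ => c) U₀ V₀ U V z).1
    (lemma16Map K r (fun _ => c) U₀ V₀ U V z).2).2 ⟨U₀, V₀, U, V, z, rfl⟩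
  exact ⟨(borderCompletionRank_le_completionRank _ _).trans h.1, h.2⟩

/-- **`C^{n,t,c}_r ⊆ \overline{im g}` (every infinite field `K`)**: every polynomial vanishing on
the image of the parametrisation `g` of Lemma 16 vanishes at every tensor of border completion rank
`≤ r` with slices of rank `≤ c`. Route: a Def. 9 witness over `K(ε)` lies in the image of `g` over
the field `K(ε)` (Lemma 16 there; the rank constraints `rk Ã_k ≤ rk A_k` of Def. 9 are used), the
identity `p ∘ g = 0` base-changes, and `p(Ã) = p(A) + O(ε)`.
[cite: BlaserIkenmeyerJindalLysikov2018, Obs. 17 ("The closure of the image of `g` is `C^{n,t,c}_r`")]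
locator: ECCC p.12 -/
theorem eval_eq_zero_of_mem_bijlVariety [Infinite K] {n t c r : ℕ}
    {A : Matrix (Fin n) (Fin n) K × (Fin t → Matrix (Fin n) (Fin n) K)}
    (hA : A ∈ bijlVariety K n t c r) {p : MvPolynomial (Option (Fin t) × Fin n × Fin n) K}
    (hp : p ∈ lemma16VanishingIdeal K n t c r) : eval (tensorPoint K A.1 A.2) p = 0 := by
  obtain ⟨hcr, hrk⟩ := hA
  obtain ⟨B₀, B, lam, hB₀, hB, -, hrkB, hpen⟩ := exists_isBorderWitness_borderCompletionRank A.1 A.2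
  -- Lemma 16 over the field `K(ε)`: the witness lies in the image of `g`
  have hcrB : completionRank B₀ B ≤ r := ((completionRank_le B₀ B lam).trans hpen).trans hcr
  have hrkB' : ∀ k, (B k).rank ≤ c := fun k => (hrkB k).trans (hrk k)
  obtain ⟨U₀, V₀, U, V, z, hg⟩ :=
    (BIJL2018_lemma16 (RatFunc K) n t r (fun _ => c) B₀ B).1 ⟨hcrB, hrkB'⟩
  -- `p ∘ g = 0` over `K`, hence over `K(ε)`
  have hpg : bind₁ (lemma16Poly K n t c r) p = 0 := (mem_lemma16VanishingIdeal_iff K p).1 hp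
  have hpgL : bind₁ (lemma16Poly (RatFunc K) n t c r) (map RatFunc.C p) = 0 := by
    have h := congrArg (map (RatFunc.C (K := K))) hpg
    rw [map_bind₁, map_zero] at h
    have hfun : (fun v => map RatFunc.C (lemma16Poly K n t c r v)) =
        lemma16Poly (RatFunc K) n t c r := funext (map_C_lemma16Poly n t c r)
    rwa [hfun] at h
  -- evaluate at the parameter point of the tuple
  have hevalL : eval (tensorPoint (RatFunc K) B₀ B) (map RatFunc.C p) = 0 := by
    have h := congrArg (eval (lemma16Point (RatFunc K) U₀ V₀ U V z)) hpgL
    rw [map_zero] at h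
    have hb : eval (lemma16Point (RatFunc K) U₀ V₀ U V z)
        (bind₁ (lemma16Poly (RatFunc K) n t c r) (map RatFunc.C p)) =
        eval (fun v => eval (lemma16Point (RatFunc K) U₀ V₀ U V z)
          (lemma16Poly (RatFunc K) n t c r v)) (map RatFunc.C p) :=
      eval₂Hom_bind₁ _ _ _ _
    rw [hb, funext (eval_lemma16Poly (RatFunc K) U₀ V₀ U V z), hg] at h
    exact h
  -- `p(Ã) = p(A) + O(ε)`
  have happ : IsApproxOf (eval (tensorPoint K A.1 A.2) p)
      (eval (tensorPoint (RatFunc K) B₀ B) (map RatFunc.C p)) := by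
    refine IsApproxOf.eval_map (fun v => ?_) p
    rcases v with ⟨_ | k, i, j⟩
    · exact hB₀ i j
    · exact hB k i j
  rw [hevalL] at happ
  exact happ.eq_zero_of_zero

/-- **Obs. 17, the inclusion `C^{n,t,c}_r ⊆ \overline{im g}`** as sets: `bijlVariety` lies in the zero
locus of the vanishing ideal of the image of `g` (every infinite field). The reverse inclusion is the
algebraically-closed-field statement of the print and is not formalised (module docstring).
[cite: BlaserIkenmeyerJindalLysikov2018, Obs. 17] locator: ECCC p.12 -/
theorem bijlVariety_subset_zeroLocus_lemma16VanishingIdeal [Infinite K] (n t c r : ℕ) :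
    bijlVariety K n t c r ⊆
      {A | ∀ p ∈ lemma16VanishingIdeal K n t c r, eval (tensorPoint K A.1 A.2) p = 0} :=
  fun _ hA _ hp => eval_eq_zero_of_mem_bijlVariety hA hp

/-- **Sandwich `im g ⊆ C^{n,t,c}_r ⊆ \overline{im g}`**, image side: the image of `g` lies in the zero
locus of its own vanishing ideal through `C^{n,t,c}_r`.
[cite: BlaserIkenmeyerJindalLysikov2018, Obs. 17] locator: ECCC p.12 -/
theorem lemma16Map_mem_zeroLocus [Infinite K] {n t c r : ℕ} (U₀ V₀ : Matrix (Fin r) (Fin n) K)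
    (U V : Fin t → Matrix (Fin c) (Fin n) K) (z : Fin t → K)
    {p : MvPolynomial (Option (Fin t) × Fin n × Fin n) K} (hp : p ∈ lemma16VanishingIdeal K n t c r) :
    eval (tensorPoint K (lemma16Map K r (fun _ => c) U₀ V₀ U V z).1
      (lemma16Map K r (fun _ => c) U₀ V₀ U V z).2) p = 0 :=
  eval_eq_zero_of_mem_bijlVariety (lemma16Map_mem_bijlVariety U₀ V₀ U V z) hp

end Literature.Barriers.ValiantsHypothesis

end
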